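/-
Copyright (c) 2026 the pub-hodgecm-mathlib formalisation cell (harness21).  Prover seat hodgecm-mathlib-K2Liu-p09 (g5): Track B «K2-LIT»,
hLiu418 = stmt-HodgeConjecture-24832; LEAD F0P6-plan RULINGS M-156m∕o, M-157a (4)∕m «A7 = GK COCYCLE ROAD», file B7-S.
-/
import Summits.HodgeConjecture.HodgeConjecture.Theorems.K2LiuRankOneFamiliesBase       -- ★ B7-N (+ ★ B3 `K2LiuRankOneOperators`)
import Literature.NumberTheory.Automorphic.GL2RSLFactorExistence                      -- ★ `exists_finset_primePowBall_eq_biUnion`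
import HarnessLib

/-!
# Crux `HLiu418`, road `K2_Liu`, organ A7-reg (GK cocycle road), file B7-S:
# ONE RANK-ONE STAGE OF THE COCYCLE — true operator `= L(e(s) − 1, ν) ·` an explicit normalised family, regular at `½`

Cell `hodgecm-mathlib`, crux item hLiu418 = `stmt-HodgeConjecture-24832`; squad K2 ∕ K2Liu; prover K2Liu-p09 (g5).  THEOREMS ONLY; lane
`--supports stmt-HodgeConjecture-24832` (count-neutral helper).  Abstract: a topological group `G`, the local field `K_w`, an additive Haar measure `μ`.
THE POINT.  The (A4′-R) face asks for an `Fn` that is a GENUINE rational function of `q_v^{-s}` at every `s` (★ F1 `IsQRationalRegularAt`), while the intertwining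
integral only converges on `1 < re s`.  So every rank-one stage of `M_v(s) = A₂ A₁ A₂` is run in two currencies at once: the TRUE operator
`(𝒯Φ_s)(g) = ∫ Φ_s(w₀ u(x) g) dμ(x)` on `1 < re s`, and the EXPLICIT normalised family `N` built from finitely many values of `Φ_s` at a level `m(g)` and
representatives `R(g)` chosen per point (★ B3 `exists_level₂`, ★ `exists_finset_primePowBall_eq_biUnion`), with `𝒯Φ_s(g) = L(e(s) − 1, ν) · N s g` on `1 < re s`
(★ B3 `integral_eq_lFactor_mul_normalised`) and `s ↦ N s g` regular at `½` in `q₀^{-s}` whenever the values of `Φ` and the constant `C₀` are (★ B7-N).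
* §1 `exists_level_and_reps` — the per-point data `(m, R)`.
* §2 `integrable_and_integral_eq_of_letters` — the fixed-function form (integrability + value), hypotheses = letters + `hrel` + right-`K′`-invariance; used for the
  `|f|`-majorant chain feeding ★ B4d-3 `integral_frameConj_weylSiegel_eq_iterated_of_chain`.
* §3 **`exists_normalised_family`** — the family form: `∃ N`, regular at `½`, with `𝒯Φ_s = L(e(s)−1, ν) N_s` and integrability on `1 < re s`; the structural
  hypotheses (`K′`-invariance, `hrel`) are only asked on `1 < re s`, where the running family is a scalar multiple of a true operator.
HONEST LABEL.  `HC_CM` is proved only modulo the 7 printed citations (2 remaining named inputs: hLiu418 = `stmt-HodgeConjecture-24832`,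
h413 = `stmt-HodgeConjecture-24833`) until rung 0 closes.

## References
* [Casselman1980] W. Casselman, *The unramified principal series of p-adic groups I*, Compositio Math. 40 (1980), §3 Thm. 3.1.
* [KudlaSweet1997] S. Kudla, W. J. Sweet, Israel J. Math. 98 (1997), §1.
* [BushnellHenniart2006] C. Bushnell, G. Henniart, *The local Langlands conjecture for GL(2)* (2006), §1.1.
-/

set_option autoImplicit false
set_option linter.dupNamespace false -- the mandated namespace repeats `HodgeConjecture.HodgeConjecture`

noncomputable section

open MeasureTheory Filter Topology Set
open scoped NNReal ENNReal
open NumberField IsDedekindDomain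
open Literature.NumberTheory.GaloisRepresentations.IsNonarchimedeanLocalField
open Literature.NumberTheory.Automorphic Literature.NumberTheory.Automorphic.LocalFieldHaar
open Summit.HodgeConjecture.HodgeConjecture.Cruxes.HLiu418.K2LiuQRationalDefs
open Summit.HodgeConjecture.HodgeConjecture.Cruxes.HLiu418.K2LiuQRationalLFactor
open Summit.HodgeConjecture.HodgeConjecture.Cruxes.HLiu418.K2LiuLocalLFactorDefs
open Summit.HodgeConjecture.HodgeConjecture.Cruxes.HLiu418.K2LiuRankOneOperators
open Summit.HodgeConjecture.HodgeConjecture.Cruxes.HLiu418.K2LiuRankOneFamiliesBase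

namespace Summit.HodgeConjecture.HodgeConjecture.Cruxes.HLiu418.K2LiuRankOneStage

variable {K : Type} [Field K] [NumberField K] {w : HeightOneSpectrum (𝓞 K)} {G : Type*} [Group G] [TopologicalSpace G] [IsTopologicalGroup G]

/-! ## §1 The per-point data: a level and representatives -/

/-- **at every point there are a level `m` and representatives `R` of `𝔭^{−m} ⧸ 𝔭^m`** (★ B3 `exists_level₂`, ★ `exists_finset_primePowBall_eq_biUnion`).
[cite: BushnellHenniart2006, §1.1] [cite: Casselman1980, §3] -/
theorem exists_level_and_reps {u ū : w.adicCompletion K → G} (hu : Continuous u) (hu0 : u 0 = 1) (hū : Continuous ū) (hū0 : ū 0 = 1)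
    (K' : Subgroup G) (hK' : IsOpen (K' : Set G)) (y : G) :
    ∃ (m : ℕ) (R : Finset (w.adicCompletion K)),
      (∀ t ∈ primePowBall (w.adicCompletion K) (m : ℤ), y⁻¹ * u t * y ∈ K') ∧
      (∀ t ∈ primePowBall (w.adicCompletion K) (m : ℤ), y⁻¹ * ū t * y ∈ K') ∧
      (∀ a ∈ R, ∀ a' ∈ R, a ≠ a' → a - a' ∉ primePowBall (w.adicCompletion K) (m : ℤ)) ∧
      primePowBall (w.adicCompletion K) (-(m : ℤ)) = ⋃ a ∈ R, {x | x - a ∈ primePowBall (w.adicCompletion K) (m : ℤ)} := by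
  obtain ⟨m, hmu, hmū⟩ := exists_level₂ u ū hu hu0 hū hū0 K' hK' y
  obtain ⟨R, -, hRinc, hRcov⟩ := exists_finset_primePowBall_eq_biUnion (F := w.adicCompletion K) (j := -(m : ℤ)) (r := (m : ℤ)) (by omega)
  exact ⟨m, R, hmu, hmū, hRinc, hRcov⟩

/-! ## §2 The fixed-function form: integrability and the value at a point -/

section Fixed

variable [MeasurableSpace (w.adicCompletion K)] [BorelSpace (w.adicCompletion K)] (μ : Measure (w.adicCompletion K)) [μ.IsAddHaarMeasure]

/-- **INTEGRABILITY OF A RANK-ONE STAGE (fixed function)**: for `f` right-invariant under an open subgroup `K′`, letters `u`, `ū` (continuous, `= 1` at `0`,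
`u` additive), a unitary `ν`, `re e > 1` and the `SL₂` relation `hrel`, the function `x ↦ f(w₀ u(x) y)` is integrable for every `y` (★ B3 at the level of §1).
[cite: Casselman1980, §3 Thm. 3.1] -/
theorem integrable_of_letters {f : G → ℂ} {K' : Subgroup G} (hK' : IsOpen (K' : Set G)) (hfK : ∀ g, ∀ k ∈ K', f (g * k) = f g)
    {u ū : w.adicCompletion K → G} (hu : Continuous u) (hu0 : u 0 = 1) (hū : Continuous ū) (hū0 : ū 0 = 1) (hu_add : ∀ x t, u (x + t) = u x * u t) (w₀ : G)
    (ν : (w.adicCompletion K)ˣ →* ℂˣ) (hν : ∀ x, ‖((ν x : ℂˣ) : ℂ)‖ = 1) (e C₀ : ℂ) (he : 1 < e.re)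
    (hrel : ∀ (x : (w.adicCompletion K)ˣ) (g : G),
      f (w₀ * u x * g) = C₀ * (((ν x)⁻¹ : ℂˣ) : ℂ) * ((normAbs (w.adicCompletion K) (x : w.adicCompletion K) : ℝ) : ℂ) ^ (-e) *
        f (ū ((x⁻¹ : (w.adicCompletion K)ˣ) : w.adicCompletion K) * g))
    (y : G) : Integrable (fun x => f (w₀ * u x * y)) μ := by
  obtain ⟨m, R, hmu, hmū, hRinc, hRcov⟩ := exists_level_and_reps hu hu0 hū hū0 K' hK' y
  exact (integrable_and_integral_eq μ hfK hu_add w₀ ν hν e C₀ he hrel y m hmu hmū R hRinc hRcov).1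

end Fixed

/-! ## §3 The family form: the explicit normalised family -/

section Family

variable [MeasurableSpace (w.adicCompletion K)] [BorelSpace (w.adicCompletion K)] (μ : Measure (w.adicCompletion K)) [μ.IsAddHaarMeasure]

/-- **ONE STAGE OF THE COCYCLE IN BOTH CURRENCIES.**  Let `Φ : ℂ → G → ℂ` be a family whose values `s ↦ Φ_s(g)` are `q₀^{-s}`-rational and regular at `½`
(`q_w = q₀^d`), and which on the half-plane `1 < re s` is right-`K′`-invariant and satisfies the `SL₂` relation with datum `(C₀(s), ν, e(s) = a s + c)` (`ν`
unitary, `C₀` regular at `½`, `re e(s) > 1` there).  Then there is an explicit family `N : ℂ → G → ℂ` with every `s ↦ N s g` regular at `½`, and on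
`1 < re s`: `x ↦ Φ_s(w₀ u(x) g)` is integrable and **`∫ Φ_s(w₀ u(x) g) dμ(x) = L(e(s) − 1, ν) · N s g`** (`N` = ★ B3's normalised value at the per-point data of §1).
[cite: Casselman1980, §3 Thm. 3.1] [cite: KudlaSweet1997, §1] -/
theorem exists_normalised_family (Φ : ℂ → G → ℂ) {K' : Subgroup G} (hK' : IsOpen (K' : Set G))
    (hΦK : ∀ s : ℂ, 1 < s.re → ∀ g, ∀ k ∈ K', Φ s (g * k) = Φ s g)
    {u ū : w.adicCompletion K → G} (hu : Continuous u) (hu0 : u 0 = 1) (hū : Continuous ū) (hū0 : ū 0 = 1) (hu_add : ∀ x t, u (x + t) = u x * u t) (w₀ : G)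
    (ν : (w.adicCompletion K)ˣ →* ℂˣ) (hν : ∀ x, ‖((ν x : ℂˣ) : ℂ)‖ = 1) (a : ℕ) (c : ℂ) (he : ∀ s : ℂ, 1 < s.re → 1 < ((a : ℂ) * s + c).re)
    (C₀ : ℂ → ℂ) (q₀ d : ℕ) (hq₀ : q₀ ≠ 0) (hq : residueFieldCard (w.adicCompletion K) = q₀ ^ d) (hC₀ : IsQRationalRegularAt q₀ (1 / 2) C₀)
    (hrel : ∀ s : ℂ, 1 < s.re → ∀ (x : (w.adicCompletion K)ˣ) (g : G),
      Φ s (w₀ * u x * g) = C₀ s * (((ν x)⁻¹ : ℂˣ) : ℂ) * ((normAbs (w.adicCompletion K) (x : w.adicCompletion K) : ℝ) : ℂ) ^ (-((a : ℂ) * s + c)) *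
        Φ s (ū ((x⁻¹ : (w.adicCompletion K)ˣ) : w.adicCompletion K) * g))
    (hreg : ∀ g, IsQRationalRegularAt q₀ (1 / 2) fun s => Φ s g) :
    ∃ N : ℂ → G → ℂ, (∀ g, IsQRationalRegularAt q₀ (1 / 2) fun s => N s g) ∧
      ∀ s : ℂ, 1 < s.re → ∀ g,
        Integrable (fun x => Φ s (w₀ * u x * g)) μ ∧
          ∫ x, Φ s (w₀ * u x * g) ∂μ = lFactor K w ν ((a : ℂ) * s + c - 1) * N s g := by
  -- the per-point data, chosen once (independently of `s`)
  choose m R hmu hmū hRinc hRcov using fun g => exists_level_and_reps hu hu0 hū hū0 K' hK' g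
  refine ⟨fun s g =>
      (1 - unramValue K w ν * (residueFieldCard (w.adicCompletion K) : ℂ) ^ (-(((a : ℂ) * s + c) - 1))) *
          (∑ b ∈ R g, (μ.real (primePowBall (w.adicCompletion K) (m g : ℤ)) : ℂ) * Φ s (w₀ * u b * g)) +
        C₀ s * Φ s g * (1 - (residueFieldCard (w.adicCompletion K) : ℂ)⁻¹) * μ.real (primePowBall (w.adicCompletion K) 0) *
          (unramValue K w ν * (residueFieldCard (w.adicCompletion K) : ℂ) ^ (1 - ((a : ℂ) * s + c))) ^ (m g + 1),
    fun g => isQRationalRegularAt_normalised_base μ q₀ d hq₀ hq Φ w₀ g ν a c C₀ (m g) (R g) hC₀ (hreg g) fun b _ => hreg _, fun s hs g => ?_⟩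
  exact ⟨(integrable_and_integral_eq μ (hΦK s hs) hu_add w₀ ν hν _ (C₀ s) (he s hs) (hrel s hs) g (m g) (hmu g) (hmū g) (R g) (hRinc g) (hRcov g)).1,
    integral_eq_lFactor_mul_normalised μ (hΦK s hs) hu_add w₀ ν hν _ (C₀ s) (he s hs) (hrel s hs) g (m g) (hmu g) (hmū g) (R g) (hRinc g) (hRcov g)⟩

end Family

end Summit.HodgeConjecture.HodgeConjecture.Cruxes.HLiu418.K2LiuRankOneStage

end
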